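import Summits.FinalStateConjecture.FinalStateConjecture.Theorems.PhotonSphereChannelsBlindnessWaveLeibniz

/-!
# Crux `UniformPhotonSphereChannels` (K1), negative side — `Cⁿ` regularity of Volterra integrals

Support file of the standing disprover of item stmt-FinalStateConjecture-10045 (`C³` solutions).
Generic form of the bootstrap step of `PhotonSphereChannelsBlindnessWaveRegularity`:

* `contDiff_volterra_snd`: if `k ∈ Cⁿ(ℝ²)`, `n ≥ 1`, then `(a, b) ↦ ∫_b^a k(s, b) ds` is `Cⁿ`;
* `contDiff_volterra_fst`: likewise `(a, b) ↦ ∫_b^a k(a, s) ds`.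

Proof: induction on `n`; the partials are `k(a,b)` and `−k(b,b) + ∫_b^a ∂_b k(s,b) ds`
(Leibniz rule `hasDerivAt_integral_param_lower`), the latter a Volterra integral of the `Cⁿ⁻¹`
kernel `∂_b k`; glue by `Literature.Analysis.Calculus.contDiffOn_succ_of_partial`. [folklore]
-/

noncomputable section

open Set Filter MeasureTheory intervalIntegral Topology Function

namespace Summit.FinalStateConjecture.FinalStateConjecture.Theorems.Blindness

/-- Continuity of `(a, b) ↦ ∫_b^a k(s, b) ds` for a jointly continuous kernel. -/
theorem continuous_volterra_snd {k : ℝ → ℝ → ℝ} (hk : Continuous (uncurry k)) :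
    Continuous fun p : ℝ × ℝ => ∫ s in p.2..p.1, k s p.2 := by
  have hu : Continuous (uncurry fun (p : ℝ × ℝ) (s : ℝ) => k s p.2) :=
    hk.comp (continuous_snd.prodMk continuous_fst.snd)
  have heq : (fun p : ℝ × ℝ => ∫ s in p.2..p.1, k s p.2)
      = fun p : ℝ × ℝ => (∫ s in (0:ℝ)..p.1, k s p.2) - ∫ s in (0:ℝ)..p.2, k s p.2 := by
    funext p
    have hx : Continuous (fun s => k s p.2) := hk.comp (Continuous.prodMk_left p.2)
    rw [integral_interval_sub_left (hx.intervalIntegrable _ _) (hx.intervalIntegrable _ _)]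
  rw [heq]
  exact (continuous_parametric_intervalIntegral_of_continuous hu continuous_fst).sub
    (continuous_parametric_intervalIntegral_of_continuous hu continuous_snd)

/-- The bootstrap step: if `k ∈ C^{m+1}` and the Volterra integral of `∂_b k` is `Cᵐ`, then the
Volterra integral of `k` is `C^{m+1}`. -/
theorem contDiff_volterra_snd_step {k : ℝ → ℝ → ℝ} {m : ℕ} (hk : ContDiff ℝ (m + 1) (uncurry k))
    (hih : ContDiff ℝ m (fun p : ℝ × ℝ =>
      ∫ s in p.2..p.1, fderiv ℝ (uncurry k) (s, p.2) (0, 1))) :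
    ContDiff ℝ (m + 1) (fun p : ℝ × ℝ => ∫ s in p.2..p.1, k s p.2) := by
  have hkc : Continuous (uncurry k) := hk.continuous
  set k₂ : ℝ → ℝ → ℝ := fun s b => fderiv ℝ (uncurry k) (s, b) (0, 1) with hk₂
  have hk₂c : Continuous (uncurry k₂) :=
    (hk.continuous_fderiv (by norm_num)).clm_apply continuous_const
  have hk₂m : ContDiff ℝ m (uncurry k₂) :=
    (hk.fderiv_right (m := m) (by norm_num)).clm_apply contDiff_const
  have hder : ∀ s b, HasDerivAt (fun b => k s b) (k₂ s b) b := fun s b =>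
    hasDerivAt_snd_of_hasFDerivAt (f := uncurry k) (p := (s, b))
      ((hk.differentiable (by norm_num)) (s, b)).hasFDerivAt
  -- partial derivatives
  have h₁ : ∀ p : ℝ × ℝ, HasDerivAt (fun a => ∫ s in p.2..a, k s p.2) (k p.1 p.2) p.1 := by
    intro p
    have hx : Continuous fun s => k s p.2 := hkc.comp (Continuous.prodMk_left p.2)
    exact integral_hasDerivAt_right (hx.intervalIntegrable _ _)
      (hx.stronglyMeasurableAtFilter _ _) hx.continuousAt
  have h₂ : ∀ p : ℝ × ℝ, HasDerivAt (fun b => ∫ s in b..p.1, k s b)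
      (-k p.2 p.2 + ∫ s in p.2..p.1, k₂ s p.2) p.2 := fun p =>
    hasDerivAt_integral_param_lower hkc hk₂c hder p.1 p.2
  -- regularity of the partial-derivative fields
  have hf₁ : ContDiff ℝ m (fun p : ℝ × ℝ => k p.1 p.2) := hk.of_le (by norm_num)
  have hf₂ : ContDiff ℝ m (fun p : ℝ × ℝ => -k p.2 p.2 + ∫ s in p.2..p.1, k₂ s p.2) := by
    refine ((hk.of_le (by norm_num : (m : WithTop ℕ∞) ≤ m + 1)).comp
      (contDiff_snd.prodMk contDiff_snd)).neg.add ?_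
    exact hih
  have h := Literature.Analysis.Calculus.contDiffOn_succ_of_partial
    (f := fun p : ℝ × ℝ => ∫ s in p.2..p.1, k s p.2) (U := univ) isOpen_univ (n := m)
    (f₁ := fun p : ℝ × ℝ => (k p.1 p.2) • (1 : ℝ →L[ℝ] ℝ))
    (f₂ := fun p : ℝ × ℝ => (-k p.2 p.2 + ∫ s in p.2..p.1, k₂ s p.2) • (1 : ℝ →L[ℝ] ℝ))
    (fun p _ => hasFDerivAt_smul_one_of_hasDerivAt (h₁ p))
    (fun p _ => hasFDerivAt_smul_one_of_hasDerivAt (h₂ p))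
    ((hf₁.smul contDiff_const).contDiffOn) ((hf₂.smul contDiff_const).contDiffOn)
  exact contDiffOn_univ.1 (by simpa using h)

/-- **`Cⁿ` regularity of Volterra integrals in the lower-limit variable**: for `k ∈ C^{m+1}(ℝ²)`,
`(a, b) ↦ ∫_b^a k(s, b) ds` is `C^{m+1}`. [folklore] -/
theorem contDiff_volterra_snd : ∀ (m : ℕ) {k : ℝ → ℝ → ℝ}, ContDiff ℝ (m + 1) (uncurry k) →
    ContDiff ℝ (m + 1) (fun p : ℝ × ℝ => ∫ s in p.2..p.1, k s p.2) := by
  intro m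
  induction m with
  | zero =>
    intro k hk
    refine contDiff_volterra_snd_step hk ?_
    have hk₂c : Continuous (uncurry fun s b => fderiv ℝ (uncurry k) (s, b) (0, 1)) :=
      (hk.continuous_fderiv (by norm_num)).clm_apply continuous_const
    exact contDiff_zero.2 (continuous_volterra_snd hk₂c)
  | succ m ih =>
    intro k hk
    refine contDiff_volterra_snd_step hk ?_
    have hk₂ : ContDiff ℝ (m + 1) (uncurry fun s b => fderiv ℝ (uncurry k) (s, b) (0, 1)) :=
      (hk.fderiv_right (m := m + 1) (by norm_num)).clm_apply contDiff_const
    exact ih hk₂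

/-- **`Cⁿ` regularity of Volterra integrals in the upper-limit variable**: for
`k ∈ C^{m+1}(ℝ²)`, `(a, b) ↦ ∫_b^a k(a, s) ds` is `C^{m+1}` (reduction to the previous case by
the swap `(a, b) ↦ (b, a)`). [folklore] -/
theorem contDiff_volterra_fst (m : ℕ) {k : ℝ → ℝ → ℝ} (hk : ContDiff ℝ (m + 1) (uncurry k)) :
    ContDiff ℝ (m + 1) (fun p : ℝ × ℝ => ∫ s in p.2..p.1, k p.1 s) := by
  -- `∫_b^a k(a, s) ds = −Φ₂[k'](b, a)` with `k'(s, b') = k(b', s)`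
  have hk' : ContDiff ℝ (m + 1) (uncurry fun s b' => k b' s) :=
    hk.comp (contDiff_snd.prodMk contDiff_fst)
  have h := (contDiff_volterra_snd m hk').comp (contDiff_snd.prodMk contDiff_fst)
  have heq : (fun p : ℝ × ℝ => ∫ s in p.2..p.1, k p.1 s)
      = fun p : ℝ × ℝ => -((fun q : ℝ × ℝ => ∫ s in q.2..q.1, k q.2 s) (p.2, p.1)) := by
    funext p
    simp only
    rw [integral_symm]
  rw [heq]
  exact h.neg

end Summit.FinalStateConjecture.FinalStateConjecture.Theorems.Blindness

end
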